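import Summits.ValiantsHypothesis.ValiantsHypothesis.Theorems.LacunarySymmetroidMatrixDescartesCensusChamberSignCell

/-!
# `MatrixDescartes` census — composing two one-orientation chamber kills into a door-A row

HONEST FRAMING.  Object-search cell `pub-symmetroid`, door-A target `DoorA26 := PosRootLawAt 2 6 19`
(stmt-ValiantsHypothesis-19979; OPEN, typed, never asserted), crux `Theses.LacunarySymmetroid.MatrixDescartes`
(stmt-ValiantsHypothesis-18050).  The chamber programme kills the two `V = 20` cells of a chamber (orientations
`det S_{i₀} > 0` / `< 0`, `i₀` the letter carrying the lowest pair sum) separately — by a sign-class certificate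
(`Census.no_twenty_on_chamber_cell`, `…_ltri`, `…_lambda`, `…_pi920`) or by an NFLOW magnitude certificate
(`Census.no_twenty_on_chamber<cid>_pos/neg`).  `Census.posRootLawOn_of_chamber_cell` composes a SIGN-CLASS half with an
arbitrary other half; this file gives the fully abstract composition `posRootLawOn_of_chamber_halves`: ANY two arguments
excluding twenties of the two orientations on an exponent vector `d` of the chamber give `PosRootLawOn 2 6 19 d`, the
degenerate case `det S_{i₀} = 0` losing the lowest monomial (Descartes, `#Z₊ < #supp ≤ 20`).  Needed for the chambers whose
two cells both die at magnitude level.  Nothing here bears on `V = 19`, on `DoorA26` as a whole (OPEN), on the crux, or on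
`VP ≠ VNP`.

[folklore] Elementary bookkeeping (the degenerate case is copied from `posRootLawOn_of_chamber_cell`); no citation exists or is needed.
-/

-- `Summit.ValiantsHypothesis.ValiantsHypothesis.…` repeats a component by the D-0017 layout
-- (single-conjunct summit), which the `dupNamespace` linter flags; the name is mandated.
set_option linter.dupNamespace false

namespace Summit.ValiantsHypothesis.ValiantsHypothesis.Theorems.LacunarySymmetroidMatrixDescartes.Census

open Polynomial Finset
open scoped BigOperators Polynomial Matrix

/-- **Two halves make a door-A row.**  For an order `σ` of the 21 pairs covering all pairs with lowest pair `σ 0 = (i₀, i₀)`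
and an exponent vector `d` of its chamber: if no real symmetric `2 × 2` pencil on `d` with `det S_{i₀} > 0` and none with
`det S_{i₀} < 0` has `20` distinct positive det-roots, then `ζ(2,6; d) ≤ 19`. [folklore] -/
theorem posRootLawOn_of_chamber_halves (σ : Fin 21 → Fin 6 × Fin 6) (i₀ : Fin 6)
    (hcov : ∀ p : Fin 6 × Fin 6, ∃ t : Fin 21, σ t = p ∨ σ t = p.swap) (h0 : σ 0 = (i₀, i₀))
    (d : Fin 6 → ℕ) (hd : StrictMono ((fun p : Fin 6 × Fin 6 => d p.1 + d p.2) ∘ σ))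
    (hpos : ∀ (S : Fin 6 → Matrix (Fin 2) (Fin 2) ℝ), (∀ l, (S l).IsSymm) →
      20 ≤ ((∑ l, ((X : ℝ[X]) ^ d l) • (S l).map C).det.roots.toFinset.filter (fun t => 0 < t)).card →
      0 < S i₀ 0 0 * S i₀ 1 1 - S i₀ 0 1 ^ 2 → False)
    (hneg : ∀ (S : Fin 6 → Matrix (Fin 2) (Fin 2) ℝ), (∀ l, (S l).IsSymm) →
      20 ≤ ((∑ l, ((X : ℝ[X]) ^ d l) • (S l).map C).det.roots.toFinset.filter (fun t => 0 < t)).card →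
      S i₀ 0 0 * S i₀ 1 1 - S i₀ 0 1 ^ 2 < 0 → False) :
    PosRootLawOn 2 6 19 d := by
  intro S hS
  by_contra hcon
  have hZ : 20 ≤ ((∑ l, ((X : ℝ[X]) ^ d l) • (S l).map C).det.roots.toFinset.filter (fun t => 0 < t)).card := by
    omega
  rcases lt_trichotomy 0 (S i₀ 0 0 * S i₀ 1 1 - S i₀ 0 1 ^ 2) with hp | hzero | hn
  · exact hpos S hS hZ hp
  · -- `det S_{i₀} = 0`: the lowest monomial is missing, Descartes gives `≤ 19`
    set P := (∑ l, ((X : ℝ[X]) ^ d l) • (S l).map C).det with hP_def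
    set W := (Finset.univ : Finset (Fin 6 × Fin 6)).image (fun p => d p.1 + d p.2) with hW_def
    have hN : W.card = 21 := card_pairSums_of_chamber σ hcov d hd
    have hq : S i₀ 0 0 * S i₀ 1 1 - S i₀ 0 1 ^ 2 = 0 := hzero.symm
    have hP : P ≠ 0 := by
      intro hP0
      have : (P.roots.toFinset.filter (fun t => 0 < t)).card = 0 := by rw [hP0]; simp
      omega
    have hsym : S i₀ 1 0 = S i₀ 0 1 := by
      have h := congrFun (congrFun (hS i₀) 1) 0
      simp only [Matrix.transpose_apply] at h
      exact h.symm
    have udiag : ∀ p : Fin 6 × Fin 6, d p.1 + d p.2 = d i₀ + d i₀ → p = (i₀, i₀) := by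
      intro p hp
      have hp' : d p.1 + d p.2 = d (σ 0).1 + d (σ 0).2 := by rw [h0]; exact hp
      rcases pair_eq_of_chamber σ hcov d hd 0 p hp' with h | h
      · rw [h, h0]
      · rw [h, h0]; rfl
    have hcoeff : P.coeff (d i₀ + d i₀) = 0 := by
      rw [hP_def, coeff_det_pencil_two_diag d S i₀ udiag, hsym, ← sq, hq]
    have hsub : P.support ⊆ W.erase (d i₀ + d i₀) := by
      intro x hx
      have hxW : x ∈ W := by
        have : P.support ⊆ W := by
          rw [hP_def, hW_def, ← sumset_two_eq_pairSums d]; exact support_det_pencil_subset_sumset d S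
        exact this hx
      refine Finset.mem_erase.mpr ⟨?_, hxW⟩
      intro hxe
      rw [hxe, Polynomial.mem_support_iff] at hx
      exact hx hcoeff
    have hcard : P.support.card ≤ 20 := by
      have h1 := Finset.card_le_card hsub
      have h2 : (W.erase (d i₀ + d i₀)).card = 20 := by
        rw [Finset.card_erase_of_mem (Finset.mem_image.mpr ⟨(i₀, i₀), Finset.mem_univ _, rfl⟩), hN]
      omega
    have h := Literature.Computability.AlgebraicComplexity.card_roots_toFinset_filter_pos_lt_card_support hP
    omega
  · exact hneg S hS hZ hn

end Summit.ValiantsHypothesis.ValiantsHypothesis.Theorems.LacunarySymmetroidMatrixDescartes.Census
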